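import Summits.PneNP.PneNP.Theorems.ChebyshevTracialDesignDimensionOne
import Summits.PneNP.PneNP.Theses.ChebyshevTracialDesign
import HarnessLib

/-!
# Cell pnp-psdrank, route `ChebyshevTracialDesign`: amplification — tracial value bounds descend from dimension `r·k` to `r`,
# in particular to the classical rectangles

`X ↦ X ⊗ I_k` (block-diagonal with `k` equal blocks) turns a tight-orthogonal psd rectangle of dimension `r` into one of dimension
`r·k` with the same normalised tracial value. Hence `TracialValueLEAt W γ (r * k) → TracialValueLEAt W γ r` (`k ≥ 1`): the sup of
the normalised value over psd rectangles is monotone along multiples of the dimension (`tracialValueLEAt_of_mul`), every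
dimension-`r` bound implies the dimension-`1` bound (`tracialValueLEAt_one_of`), i.e. — by `tracialValueLEAt_one_iff` — the
classical rectangle bound (`rectangles_of_tracialValueLEAt`). Consequence for the route: the crux `TracialDecayExp20` (stmt-PneNP-19878)
implies its classical `r = 1` shadow at the exp scale, Rothvoß-type: every tight-free 0/1 rectangle has design mass `≤ exp(−a·dq n)`
(`rectangleDecay_of_tracialDecayExp20`) — so planner p1's plan-only stub `stub_rung_r1Exp` is a genuine CONSEQUENCE of the crux (a
necessary first rung), as the skeleton intends. WHAT THIS IS NOT: no decay proved; API only. Supports stmt-PneNP-19878.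
-/

set_option linter.dupNamespace false -- `Summit.PneNP.PneNP.…`: summit = sub-problem (D-0017)

noncomputable section

open scoped Classical MatrixOrder

namespace Summit.PneNP.PneNP.Theorems.ChebyshevTracialDesignDimensionOne

open Finset Matrix Literature.Barriers.PneNP Literature.Combinatorics.Optimization
  Literature.Computation.Certificates.SemidefiniteComplementarity

variable {n : ℕ}

/-! ### §1 Block-diagonal amplification `X ↦ X ⊗ I_k` -/

/-- A block-diagonal matrix with psd blocks is psd (Gram form blockwise). -/
theorem posSemidef_blockDiagonal {o d : Type} [Fintype o] [DecidableEq o] [Fintype d] [DecidableEq d]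
    {A : o → Matrix d d ℝ} (h : ∀ k, (A k).PosSemidef) : (blockDiagonal A).PosSemidef := by
  choose C hC using fun k => exists_eq_conjTranspose_mul_self (h k)
  have hblk : blockDiagonal A = (blockDiagonal C)ᴴ * blockDiagonal C := by
    rw [blockDiagonal_conjTranspose, ← blockDiagonal_mul]
    congr 1
    funext k
    exact hC k
  rw [hblk]
  exact posSemidef_conjTranspose_mul_self _

/-- The amplified factor `X ⊗ I_k` on `Fin (r·k)`. -/
def amplify (r k : ℕ) (X : Matrix (Fin r) (Fin r) ℝ) : Matrix (Fin (r * k)) (Fin (r * k)) ℝ :=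
  (blockDiagonal fun _ : Fin k => X).submatrix finProdFinEquiv.symm finProdFinEquiv.symm

/-- `X ⪰ 0 ⇒ X ⊗ I_k ⪰ 0`. -/
theorem posSemidef_amplify {r k : ℕ} {X : Matrix (Fin r) (Fin r) ℝ} (hX : X.PosSemidef) :
    (amplify r k X).PosSemidef :=
  (posSemidef_blockDiagonal fun _ => hX).submatrix _

/-- `amplify` is additive: `(A − B) ⊗ I_k = A ⊗ I_k − B ⊗ I_k`. -/
theorem amplify_sub (r k : ℕ) (A B : Matrix (Fin r) (Fin r) ℝ) :
    amplify r k (A - B) = amplify r k A - amplify r k B := by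
  unfold amplify
  rw [show (fun _ : Fin k => A - B) = (fun _ : Fin k => A) - (fun _ : Fin k => B) from rfl, blockDiagonal_sub]
  rfl

/-- `I_r ⊗ I_k = I_{rk}`. -/
theorem amplify_one (r k : ℕ) : amplify r k (1 : Matrix (Fin r) (Fin r) ℝ) = 1 := by
  unfold amplify
  rw [show (fun _ : Fin k => (1 : Matrix (Fin r) (Fin r) ℝ)) = 1 from rfl, blockDiagonal_one, submatrix_one_equiv]

/-- `1 − X ⊗ I_k = (1 − X) ⊗ I_k`. -/
theorem one_sub_amplify (r k : ℕ) (X : Matrix (Fin r) (Fin r) ℝ) :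
    1 - amplify r k X = amplify r k (1 - X) := by
  rw [amplify_sub, amplify_one]

/-- `(X ⊗ I_k)(Y ⊗ I_k) = (XY) ⊗ I_k`. -/
theorem amplify_mul (r k : ℕ) (X Y : Matrix (Fin r) (Fin r) ℝ) :
    amplify r k X * amplify r k Y = amplify r k (X * Y) := by
  unfold amplify
  rw [submatrix_mul_equiv, ← blockDiagonal_mul]

/-- `0 ⊗ I_k = 0`. -/
theorem amplify_zero (r k : ℕ) : amplify r k (0 : Matrix (Fin r) (Fin r) ℝ) = 0 := by
  unfold amplify
  rw [show (fun _ : Fin k => (0 : Matrix (Fin r) (Fin r) ℝ)) = 0 from rfl, blockDiagonal_zero]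
  rfl

/-- `tr(X ⊗ I_k) = k · tr X`. -/
theorem trace_amplify (r k : ℕ) (X : Matrix (Fin r) (Fin r) ℝ) : (amplify r k X).trace = k * X.trace := by
  unfold amplify
  have : ((blockDiagonal fun _ : Fin k => X).submatrix (finProdFinEquiv.symm) (finProdFinEquiv.symm)).trace =
      (blockDiagonal fun _ : Fin k => X).trace := by
    simp only [Matrix.trace, Matrix.diag, submatrix_apply]
    exact Fintype.sum_equiv finProdFinEquiv.symm _ _ fun _ => rfl
  rw [this, trace_blockDiagonal, sum_const, card_univ, Fintype.card_fin, nsmul_eq_mul]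

/-! ### §2 Descent of tracial value bounds -/

/-- **Amplification**: a tracial value bound in dimension `r·k` (`k ≥ 1`) gives the same bound in dimension `r`. -/
theorem tracialValueLEAt_of_mul (W : OddSet n → PMatch n → ℝ) (γ : ℝ) {r k : ℕ} (hk : 0 < k)
    (h : TracialValueLEAt W γ (r * k)) : TracialValueLEAt W γ r := by
  intro X Y hXY
  have hamp : IsPsdRect (fun U => amplify r k (X U)) (fun M => amplify r k (Y M)) := by
    refine ⟨fun U => ⟨posSemidef_amplify (hXY.1 U).1, ?_⟩, fun M => ⟨posSemidef_amplify (hXY.2.1 M).1, ?_⟩,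
      fun U M hcc => ?_⟩
    · rw [one_sub_amplify]; exact posSemidef_amplify (hXY.1 U).2
    · rw [one_sub_amplify]; exact posSemidef_amplify (hXY.2.1 M).2
    · rw [amplify_mul, hXY.2.2 U M hcc, amplify_zero]
  have hv := h _ _ hamp
  have htr : ∀ U M, (amplify r k (X U) * amplify r k (Y M)).trace = k * (X U * Y M).trace := fun U M => by
    rw [amplify_mul, trace_amplify]
  simp_rw [htr] at hv
  have hk' : (0 : ℝ) < k := by exact_mod_cast hk
  rcases Nat.eq_zero_or_pos r with hr | hr
  · -- dimension `0`: both values are `0`, and `0 ≤ γ` from `hv`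
    subst hr
    have h0 : ∀ U M, (X U * Y M).trace = 0 := fun U M => by simp [Matrix.trace]
    simp only [h0, mul_zero, sum_const_zero, zero_div] at hv ⊢
    exact hv
  · have hr' : (0 : ℝ) < r := by exact_mod_cast hr
    have heq : (∑ U, ∑ M, W U M * ((k : ℝ) * (X U * Y M).trace)) / ((r * k : ℕ) : ℝ) =
        (∑ U, ∑ M, W U M * (X U * Y M).trace) / r := by
      rw [Nat.cast_mul, div_eq_div_iff (by positivity) hr'.ne']
      rw [Finset.sum_mul, Finset.sum_mul]
      refine sum_congr rfl fun U _ => ?_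
      rw [Finset.sum_mul, Finset.sum_mul]
      exact sum_congr rfl fun M _ => by ring
    rw [heq] at hv
    exact hv

/-- Every dimension-`r` bound (`r ≥ 1`) implies the dimension-`1` bound. -/
theorem tracialValueLEAt_one_of (W : OddSet n → PMatch n → ℝ) (γ : ℝ) {r : ℕ} (hr : 0 < r)
    (h : TracialValueLEAt W γ r) : TracialValueLEAt W γ 1 :=
  tracialValueLEAt_of_mul W γ hr (by rwa [one_mul])

/-- **Every tracial value bound implies the classical rectangle bound**: if `TracialValueLEAt W γ r` for some `r ≥ 1` then
every tight-free 0/1 rectangle has `W`-mass `≤ γ`. -/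
theorem rectangles_of_tracialValueLEAt (W : OddSet n → PMatch n → ℝ) (γ : ℝ) {r : ℕ} (hr : 0 < r)
    (h : TracialValueLEAt W γ r) (A : Finset (OddSet n)) (B : Finset (PMatch n))
    (hAB : ∀ U ∈ A, ∀ M ∈ B, cc U M ≠ 1) : ∑ U ∈ A, ∑ M ∈ B, W U M ≤ γ :=
  (tracialValueLEAt_one_iff W γ).1 (tracialValueLEAt_one_of W γ hr h) A B hAB

/-! ### §3 The crux implies its classical shadow at the exp scale -/

/-- **`TracialDecayExp20` implies the exp-scale rectangle decay** (the `r = 1` shadow; planner p1's plan-only stub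
`stub_rung_r1Exp` is a consequence of the crux): for some `a > 0` and all large even `n`, every balanced `B = 20` design weight
has mass `≤ exp(−a·dq n)` on every tight-free 0/1 rectangle. -/
theorem rectangleDecay_of_tracialDecayExp20 (h : Summit.PneNP.PneNP.Theses.ChebyshevTracialDesign.TracialDecayExp20) :
    ∃ a : ℝ, 0 < a ∧ ∃ n₁ : ℕ, ∀ n : ℕ, n₁ ≤ n → Even n → ∀ (t : ℕ) (C : Finset ℕ) (w : ℕ → ℝ),
      IsBalancedDesign n t (Tq n) (dq n) 20 C w →
        ∀ (A : Finset (OddSet n)) (B : Finset (PMatch n)), (∀ U ∈ A, ∀ M ∈ B, cc U M ≠ 1) →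
          ∑ U ∈ A, ∑ M ∈ B, levelWeight n t C w U M ≤ Real.exp (-(a * (dq n : ℝ))) := by
  obtain ⟨a, ha, n₁, H⟩ := h
  -- budget at `r = 1`: `n < exp(a · dq n)` for `n` large (`dq n ≥ n^{1/4}/2` eventually; use `dq n ≥ K` with `a K > log`-free route:
  -- `n ≤ (dq n + 1)^4`-type growth is not needed — we only need SOME `n` range; take `n` with `a · dq n > log n`, guaranteed by
  -- `Real.add_pow_le_pow_mul_pow_of_sq_le_sq`-free elementary route: `log n ≤ 4 log (dq n + 1) + O(1) ≤ a dq n` for large `dq n`).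
  -- Elementary: `n < (dq n + 1)^4 + ...`; we use the tree lemma `lt_dq_succ_pow_four` shape via `Nat.lt_succ_sqrt'` twice.
  have hgrow : ∃ N : ℕ, ∀ n ≥ N, (n : ℝ) < Real.exp (a * (dq n : ℝ)) := by
    -- `(D+1)^4 < exp(a D)` for large `D`, and `n < (dq n + 1)^4`
    obtain ⟨D₀, hD₀⟩ : ∃ D₀ : ℕ, ∀ D ≥ D₀, ((D : ℝ) + 1) ^ 4 < Real.exp (a * D) := by
      -- `x⁴ e^{−x} → 0` along `x = a·D`
      have h2 : Filter.Tendsto (fun D : ℕ => (a * (D : ℝ)) ^ 4 * Real.exp (-(a * (D : ℝ)))) Filter.atTop (nhds 0) :=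
        (Real.tendsto_pow_mul_exp_neg_atTop_nhds_zero 4).comp
          (tendsto_natCast_atTop_atTop.const_mul_atTop ha)
      have h3 : ∀ᶠ D : ℕ in Filter.atTop, (a * (D : ℝ)) ^ 4 * Real.exp (-(a * (D : ℝ))) < a ^ 4 / 16 :=
        h2.eventually (gt_mem_nhds (by positivity))
      obtain ⟨D₁, hD₁⟩ := Filter.eventually_atTop.1 h3
      refine ⟨max D₁ 1, fun D hD => ?_⟩
      have hD1 : (1 : ℝ) ≤ D := by exact_mod_cast le_trans (le_max_right _ _) hD
      have hlt := hD₁ D (le_trans (le_max_left _ _) hD)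
      have hexp : 0 < Real.exp (a * D) := Real.exp_pos _
      rw [Real.exp_neg, ← div_eq_mul_inv, div_lt_iff₀ hexp] at hlt
      -- `(D+1)^4 ≤ 16 D^4 = (16/a^4) (aD)^4 < exp(aD)`
      have h16 : ((D : ℝ) + 1) ^ 4 ≤ 16 * (D : ℝ) ^ 4 := by
        have h2D : (D : ℝ) + 1 ≤ 2 * D := by linarith
        calc ((D : ℝ) + 1) ^ 4 ≤ (2 * (D : ℝ)) ^ 4 := pow_le_pow_left₀ (by positivity) h2D 4
          _ = 16 * (D : ℝ) ^ 4 := by ring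
      have ha4 : 0 < a ^ 4 := by positivity
      have hre : 16 * (D : ℝ) ^ 4 = (16 / a ^ 4) * (a * D) ^ 4 := by field_simp
      have h5 : (16 / a ^ 4) * (a * (D : ℝ)) ^ 4 < (16 / a ^ 4) * (a ^ 4 / 16 * Real.exp (a * D)) :=
        mul_lt_mul_of_pos_left hlt (by positivity)
      have h6 : (16 / a ^ 4) * (a ^ 4 / 16 * Real.exp (a * D)) = Real.exp (a * D) := by
        field_simp
      linarith
    refine ⟨(D₀ ^ 2) ^ 2, fun n hn => ?_⟩
    have hdq : D₀ ≤ dq n := by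
      rw [dq]; exact Nat.le_sqrt.2 (Nat.le_sqrt.2 (by simpa [sq] using hn))
    have hn4 : n < (dq n + 1) ^ 4 := by
      have h1 : n < (Nat.sqrt n + 1) ^ 2 := by have := Nat.lt_succ_sqrt' n; simpa [sq] using this
      have h2 : Nat.sqrt n < (dq n + 1) ^ 2 := by
        have := Nat.lt_succ_sqrt' (Nat.sqrt n); rw [dq]; simpa [sq] using this
      calc n < (Nat.sqrt n + 1) ^ 2 := h1
        _ ≤ ((dq n + 1) ^ 2) ^ 2 := Nat.pow_le_pow_left (by omega) 2
        _ = (dq n + 1) ^ 4 := by ring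
    have hn4' : (n : ℝ) < ((dq n : ℝ) + 1) ^ 4 := by exact_mod_cast hn4
    exact hn4'.trans (hD₀ (dq n) hdq)
  obtain ⟨N, hN⟩ := hgrow
  refine ⟨a, ha, max n₁ N, fun n hn he t C w hdes A B hAB => ?_⟩
  have h1 := H n (le_trans (le_max_left _ _) hn) he t C w hdes 1 one_pos
    (by rw [Nat.cast_one, one_pow, one_mul]; exact hN n (le_trans (le_max_right _ _) hn))
  exact rectangles_of_tracialValueLEAt _ _ one_pos h1 A B hAB

end Summit.PneNP.PneNP.Theorems.ChebyshevTracialDesignDimensionOne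

end
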